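import Summits.Ventures.LatticeQCDFlow.Exactness.Phi4FlowSamplerErgodic
import Summits.Ventures.LatticeQCDFlow.Exactness.Phi4IndependenceSamplerExact
import Mathlib.MeasureTheory.Integral.Prod
import Mathlib.Analysis.SpecialFunctions.Pow.Real
import HarnessLib

/-!
# The flow sampler's equilibrium acceptance is squeezed by the model–target overlap: `m² ≤ ā ≤ m`, `m = 1 − TV(π, q̃)`

HONEST FRAMING: exact (Metropolis-corrected) sampling algorithms for lattice gauge theory;
figures of merit are autocorrelation/cost numbers at stated couplings and volumes; no
continuum-physics claim.  (SCALAR calibration rung S0-A: not a gauge result.)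

Venture `LatticeQCDFlow` (cell pub-lqcd), topic `Exactness`; FANOUT row 2 (`s0-phi4`, FLOW arm:
the acceptance column of the flow sampler).  NEW WORK of the cell (two pointwise inequalities and
iterated integrals over Mathlib; row 2's `Phi4IndependenceSamplerExact.lean` for the lattice
vocabulary); nothing is cited as a fact.  Printed counterparts, named only: Albergo–Kanwar–Shanahan
2019 §II.C and Nicoli et al. 2020 (the acceptance rate as the flow-quality diagnostic), Liu 1996.

## What is proved

General measure space `(X, μ)` (`μ` s-finite), TARGET probability density `p ≥ 0` and MODEL
probability density `q ≥ 0` (`∫ p = ∫ q = 1`, both measurable).  The independence sampler accepts a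
proposal `y ∼ q` from `x` with `min(1, p(y)q(x)/(p(x)q(y)))`; its EQUILIBRIUM acceptance rate is
`ā = ∫∫ min(p(x)q(y), p(y)q(x)) dμ(x) dμ(y)` (`meanAccept_eq`: `= ∫ A(x) p(x) dμ(x)` with `A` the
per-state acceptance mass), and the OVERLAP of model and target is `m = ∫ min(p, q) dμ = 1 − TV(p, q)`.

* `integral_min_mul_le` — for every `x`: `∫ min(p(x)q(y), p(y)q(x)) dμ(y) ≤ min(p(x), q(x))`;
  **`meanAccept_le_overlap`** — `ā ≤ m`.
* `min_mul_min_le` — `min(p x, q x)·min(p y, q y) ≤ min(p(x)q(y), p(y)q(x))`;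
  **`overlap_sq_le_meanAccept`** — `m² ≤ ā`.
* **`tv_bounds_of_meanAccept`** — hence `1 − √ā ≤ TV(p, q) ≤ 1 − ā` with `TV = 1 − m`: the
  acceptance column of an exact flow sampler CERTIFIES the flow's total-variation error to within a
  square root, model-free (no Gaussianity, no weight bound).
* §2 `phi4Flow_meanAccept_bounds` — the lattice φ⁴ instance (`λ > 0`, any real `J`, positive
  model density with `∫ q̃ = 1`): with `p = e^{−S}/Z`,
  `(∫ min(e^{−S}/Z, q̃))² ≤ Z⁻¹ ∫∫ min(e^{−S(φ)} q̃(φ'), e^{−S(φ')} q̃(φ)) ≤ ∫ min(e^{−S}/Z, q̃)`.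

Reading for S0-A (no numerics implied): a flow arm reporting equilibrium acceptance `ā = 0.70` has
`0.16 ≤ TV(π, q̃) ≤ 0.30`; `ā → 1` iff `TV → 0`, at the stated rates.  NOT CLAIMED: bounds on
`W = sup p/q̃` (TV does not control the supremum), anything out of equilibrium.
-/

namespace Summit.Ventures.LatticeQCDFlow.Exactness

open Real MeasureTheory Filter

/-! ## §1 General state space -/

section General

variable {X : Type*} [MeasurableSpace X] {μ : Measure X} {p q : X → ℝ}

omit [MeasurableSpace X] in
/-- `min(p x, q x) · min(p y, q y) ≤ min(p(x)q(y), p(y)q(x))` for nonnegative densities. -/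
theorem min_mul_min_le (hp0 : ∀ x, 0 ≤ p x) (hq0 : ∀ x, 0 ≤ q x) (x y : X) :
    min (p x) (q x) * min (p y) (q y) ≤ min (p x * q y) (p y * q x) := by
  refine le_min ?_ ?_
  · exact mul_le_mul (min_le_left _ _) (min_le_right _ _) (le_min (hp0 y) (hq0 y)) (hp0 x)
  · rw [mul_comm]
    exact mul_le_mul (min_le_left _ _) (min_le_right _ _) (le_min (hp0 x) (hq0 x)) (hp0 y)

/-- The inner integrand is integrable in `y` (dominated by `p(x) q(y)`). -/
theorem integrable_min_mul (hp0 : ∀ x, 0 ≤ p x) (hpm : Measurable p) (hq0 : ∀ x, 0 ≤ q x)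
    (hqm : Measurable q) (hqi : Integrable q μ) (x : X) :
    Integrable (fun y => min (p x * q y) (p y * q x)) μ := by
  refine Integrable.mono' (hqi.const_mul (p x))
    ((measurable_const.mul hqm).min (hpm.mul measurable_const)).aestronglyMeasurable
    (Eventually.of_forall fun y => ?_)
  rw [Real.norm_eq_abs, abs_of_nonneg (le_min (mul_nonneg (hp0 x) (hq0 y)) (mul_nonneg (hp0 y) (hq0 x)))]
  exact min_le_left _ _

/-- **Per-state bound**: `∫ min(p(x)q(y), p(y)q(x)) dμ(y) ≤ min(p(x), q(x))` (`∫ p = ∫ q = 1`). -/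
theorem integral_min_mul_le (hp0 : ∀ x, 0 ≤ p x) (hpm : Measurable p) (hpi : Integrable p μ)
    (hp1 : ∫ x, p x ∂μ = 1) (hq0 : ∀ x, 0 ≤ q x) (hqm : Measurable q) (hqi : Integrable q μ)
    (hq1 : ∫ x, q x ∂μ = 1) (x : X) :
    ∫ y, min (p x * q y) (p y * q x) ∂μ ≤ min (p x) (q x) := by
  have hint := integrable_min_mul hp0 hpm hq0 hqm hqi x
  refine le_min ?_ ?_
  · calc ∫ y, min (p x * q y) (p y * q x) ∂μ ≤ ∫ y, p x * q y ∂μ :=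
          integral_mono hint (hqi.const_mul _) fun y => min_le_left _ _
      _ = p x := by rw [integral_const_mul, hq1, mul_one]
  · calc ∫ y, min (p x * q y) (p y * q x) ∂μ ≤ ∫ y, p y * q x ∂μ :=
          integral_mono hint (hpi.mul_const _) fun y => min_le_right _ _
      _ = q x := by rw [integral_mul_const, hp1, one_mul]

variable [SFinite μ]

/-- The outer integrand `x ↦ ∫ min(p(x)q(y), p(y)q(x)) dμ(y)` is measurable and integrable. -/
theorem integrable_integral_min_mul (hp0 : ∀ x, 0 ≤ p x) (hpm : Measurable p) (hpi : Integrable p μ)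
    (hq0 : ∀ x, 0 ≤ q x) (hqm : Measurable q) (hqi : Integrable q μ) (hq1 : ∫ x, q x ∂μ = 1) :
    Integrable (fun x => ∫ y, min (p x * q y) (p y * q x) ∂μ) μ := by
  have hF : Measurable fun z : X × X => min (p z.1 * q z.2) (p z.2 * q z.1) :=
    ((hpm.comp measurable_fst).mul (hqm.comp measurable_snd)).min
      ((hpm.comp measurable_snd).mul (hqm.comp measurable_fst))
  have hmeas : Measurable fun x => ∫ y, min (p x * q y) (p y * q x) ∂μ :=
    (hF.stronglyMeasurable.integral_prod_right (ν := μ)).measurable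
  refine Integrable.mono' hpi hmeas.aestronglyMeasurable (Eventually.of_forall fun x => ?_)
  have h0 : 0 ≤ ∫ y, min (p x * q y) (p y * q x) ∂μ :=
    integral_nonneg fun y => le_min (mul_nonneg (hp0 x) (hq0 y)) (mul_nonneg (hp0 y) (hq0 x))
  rw [Real.norm_eq_abs, abs_of_nonneg h0]
  calc ∫ y, min (p x * q y) (p y * q x) ∂μ ≤ ∫ y, p x * q y ∂μ :=
        integral_mono (integrable_min_mul hp0 hpm hq0 hqm hqi x) (hqi.const_mul _)
          fun y => min_le_left _ _
    _ = p x := by rw [integral_const_mul, hq1, mul_one]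

/-- **`ā ≤ m`**: the equilibrium acceptance is at most the overlap `∫ min(p, q)`. -/
theorem meanAccept_le_overlap (hp0 : ∀ x, 0 ≤ p x) (hpm : Measurable p) (hpi : Integrable p μ)
    (hp1 : ∫ x, p x ∂μ = 1) (hq0 : ∀ x, 0 ≤ q x) (hqm : Measurable q) (hqi : Integrable q μ)
    (hq1 : ∫ x, q x ∂μ = 1) :
    ∫ x, ∫ y, min (p x * q y) (p y * q x) ∂μ ∂μ ≤ ∫ x, min (p x) (q x) ∂μ :=
  integral_mono (integrable_integral_min_mul hp0 hpm hpi hq0 hqm hqi hq1)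
    (hpi.inf hqi)
    fun x => integral_min_mul_le hp0 hpm hpi hp1 hq0 hqm hqi hq1 x

/-- **`m² ≤ ā`**: the squared overlap is at most the equilibrium acceptance. -/
theorem overlap_sq_le_meanAccept (hp0 : ∀ x, 0 ≤ p x) (hpm : Measurable p) (hpi : Integrable p μ)
    (hq0 : ∀ x, 0 ≤ q x) (hqm : Measurable q) (hqi : Integrable q μ) (hq1 : ∫ x, q x ∂μ = 1) :
    (∫ x, min (p x) (q x) ∂μ) ^ 2 ≤ ∫ x, ∫ y, min (p x * q y) (p y * q x) ∂μ ∂μ := by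
  have hmi : Integrable (fun x => min (p x) (q x)) μ := hpi.inf hqi
  have e : (∫ x, min (p x) (q x) ∂μ) ^ 2
      = ∫ x, ∫ y, min (p x) (q x) * min (p y) (q y) ∂μ ∂μ := by
    simp_rw [integral_const_mul]
    rw [integral_mul_const, sq]
  rw [e]
  refine integral_mono ?_ (integrable_integral_min_mul hp0 hpm hpi hq0 hqm hqi hq1) fun x => ?_
  · simp_rw [integral_const_mul]
    exact hmi.mul_const _
  · exact integral_mono (hmi.const_mul _) (integrable_min_mul hp0 hpm hq0 hqm hqi x)
      fun y => min_mul_min_le hp0 hq0 x y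

/-- **THE ACCEPTANCE RATE CERTIFIES THE FLOW'S TOTAL-VARIATION ERROR**: with
`ā = ∫∫ min(p(x)q(y), p(y)q(x))` the equilibrium acceptance and `TV = 1 − ∫ min(p, q)` the total
variation distance between target and model, `1 − √ā ≤ TV ≤ 1 − ā`. -/
theorem tv_bounds_of_meanAccept (hp0 : ∀ x, 0 ≤ p x) (hpm : Measurable p) (hpi : Integrable p μ)
    (hp1 : ∫ x, p x ∂μ = 1) (hq0 : ∀ x, 0 ≤ q x) (hqm : Measurable q) (hqi : Integrable q μ)
    (hq1 : ∫ x, q x ∂μ = 1) :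
    1 - Real.sqrt (∫ x, ∫ y, min (p x * q y) (p y * q x) ∂μ ∂μ) ≤ 1 - ∫ x, min (p x) (q x) ∂μ
      ∧ 1 - ∫ x, min (p x) (q x) ∂μ ≤ 1 - ∫ x, ∫ y, min (p x * q y) (p y * q x) ∂μ ∂μ := by
  have hm0 : 0 ≤ ∫ x, min (p x) (q x) ∂μ := integral_nonneg fun x => le_min (hp0 x) (hq0 x)
  have hlo := overlap_sq_le_meanAccept hp0 hpm hpi hq0 hqm hqi hq1
  have hhi := meanAccept_le_overlap hp0 hpm hpi hp1 hq0 hqm hqi hq1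
  refine ⟨?_, by linarith⟩
  have : ∫ x, min (p x) (q x) ∂μ ≤ Real.sqrt (∫ x, ∫ y, min (p x * q y) (p y * q x) ∂μ ∂μ) := by
    rw [← Real.sqrt_sq hm0]
    exact Real.sqrt_le_sqrt hlo
  linarith

omit [SFinite μ] in
/-- **`ā` is the stationary mean of the per-state acceptance mass**: for `p > 0`,
`∫∫ min(p(x)q(y), p(y)q(x)) = ∫ (∫ min(1, p(y)q(x)/(p(x)q(y))) q(y) dμ(y)) p(x) dμ(x)` (for `q > 0`). -/
theorem meanAccept_eq (hp0 : ∀ x, 0 < p x) (hq0 : ∀ x, 0 < q x) :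
    ∫ x, ∫ y, min (p x * q y) (p y * q x) ∂μ ∂μ
      = ∫ x, (∫ y, min 1 (p y * q x / (p x * q y)) * q y ∂μ) * p x ∂μ := by
  refine integral_congr_ae (Eventually.of_forall fun x => ?_)
  dsimp only
  rw [← integral_mul_const]
  refine integral_congr_ae (Eventually.of_forall fun y => ?_)
  dsimp only
  rw [imh_accept_mul_weight p q (hp0 x) (hq0 y)]
  rfl

end General

/-! ## §2 The lattice φ⁴ flow sampler -/

section Lattice

open Summit.Ventures.LatticeQCDFlow.Scoring

variable {n : ℕ}

/-- **Acceptance–overlap squeeze for the φ⁴ flow sampler.**  `λ > 0`, any real `J`; model density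
`q̃ > 0` measurable with `∫ q̃ = 1`; target density `p = e^{−S}/Z`.  With the overlap
`m = ∫ min(e^{−S}/Z, q̃)` and the equilibrium acceptance `ā = ∫∫ min(p(φ)q̃(φ'), p(φ')q̃(φ))`:
`m² ≤ ā ≤ m`, hence `1 − √ā ≤ TV(π, q̃) ≤ 1 − ā`. -/
theorem phi4Flow_meanAccept_bounds {lam : ℝ} (hlam : 0 < lam) (J : Fin (n + 1) → Fin (n + 1) → ℝ)
    {q : (Fin (n + 1) → ℝ) → ℝ} (hq0 : ∀ φ, 0 < q φ) (hqm : Measurable q) (hqi : Integrable q)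
    (hq1 : ∫ φ, q φ = 1) :
    (∫ φ, min (gibbsWeight J lam φ / gibbsZ J lam) (q φ)) ^ 2
        ≤ ∫ φ, ∫ φ', min (gibbsWeight J lam φ / gibbsZ J lam * q φ')
            (gibbsWeight J lam φ' / gibbsZ J lam * q φ)
      ∧ ∫ φ, ∫ φ', min (gibbsWeight J lam φ / gibbsZ J lam * q φ')
            (gibbsWeight J lam φ' / gibbsZ J lam * q φ)
        ≤ ∫ φ, min (gibbsWeight J lam φ / gibbsZ J lam) (q φ) := by
  have hZ := gibbsZ_pos hlam J
  have hp0 : ∀ φ, 0 ≤ gibbsWeight J lam φ / gibbsZ J lam := fun φ =>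
    div_nonneg (gibbsWeight_pos J lam φ).le hZ.le
  have hpm : Measurable fun φ => gibbsWeight J lam φ / gibbsZ J lam :=
    (continuous_gibbsWeight J lam).measurable.div_const _
  have hpi : Integrable fun φ => gibbsWeight J lam φ / gibbsZ J lam :=
    (integrable_gibbsWeight hlam J).div_const _
  have hp1 : ∫ φ, gibbsWeight J lam φ / gibbsZ J lam = 1 := by
    rw [integral_div]
    unfold gibbsZ
    exact div_self (by unfold gibbsZ at hZ; exact hZ.ne')
  exact ⟨overlap_sq_le_meanAccept hp0 hpm hpi (fun φ => (hq0 φ).le) hqm hqi hq1,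
    meanAccept_le_overlap hp0 hpm hpi hp1 (fun φ => (hq0 φ).le) hqm hqi hq1⟩

end Lattice

end Summit.Ventures.LatticeQCDFlow.Exactness
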